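import Mathlib
import Literature.Computability.AlgebraicComplexity.ArithCircuitProofs
import Literature.Computability.AlgebraicComplexity.IMMInVPProofs
import Summits.ValiantsHypothesis.ValiantsHypothesis.Theorems.DivisionGapTriangularDimersDivisionEasyDefs
import Summits.ValiantsHypothesis.ValiantsHypothesis.Theorems.DivisionGapTriangularDimersDivisionEasyStubShufflingDivisionAux1
import Summits.ValiantsHypothesis.ValiantsHypothesis.Theorems.DivisionGapTriangularDimersDivisionEasyStubRhombusExtractionAux1

/-!
# Crux `DivisionGap.TriangularDimersDivisionEasy` (stmt-ValiantsHypothesis-5067), line `diagonal-spider-shuffling` —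
registered stub `stub_rhombusExtraction`

RHOMBUS EXTRACTION: if a cofinal supergraph family `(E m on Fin (sz m))_m` of the even rhombi has
polynomial DIVISION complexity — `L₊(pm (E m) · h) + L₊(h) ≤ (m + C) ^ C` for some non-zero
`h ∈ ℝ≥0[x]` — and initial forms are free for monotone circuits over `ℝ≥0`, then the crux's own
polynomial `D_n` (dimer polynomial of the `n × n` triangular rhombus in doubled oriented edge
variables) has polynomial division complexity `(n + c) ^ c`.

## Proof (ε-weights + free initial forms)

* odd `n`: `D_n = 0` (a fixed-point-free involution of `Fin n × Fin n` forces `n²` even), take `h = 1`;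
* even `n`: `Cofinal` embeds `R_n` into `E = E m`, `m ≤ (n + B) ^ B`, by `ι` (edges to edges) with an
  outer perfect matching `g` of `(range ι)ᶜ` inside `E`.  RELABEL (`rename lab`, free) the oriented
  variables of `pm E`: rhombus edges keep their name `Sum.inl (v, w)` (ε-weight `0`), the edges
  `(u, g u)` of the outer matching become `ε₁` (weight `1`), all other pairs `ε₂` (weight `2`).  By the
  KEY LEMMA of helper file 1 (`Extraction.rhombusExtraction_key`) the lowest ε-component of
  `rename lab (pm E)` is `ε₁ ^ K · D_n`; lowest components multiply
  (`Extraction.weightedHomogeneousComponent_mul_of_le`,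
  from Mathlib's `MvPowerSeries.weightedHomogeneousComponent_mul_of_le_weightedOrder`), so with
  `HL` the lowest component of `rename lab h ≠ 0`:
  `ε₁ ^ K · D_n · HL = lowest component of rename lab (pm E · h)`, and both `HL` and the right-hand
  side are FREE (`hI`).  Finally set `ε₁ = ε₂ = 1` (free substitution; `HL(x, 1, 1) ≠ 0` by
  positivity): `D_n · h' = g'` with `L₊(g') + L₊(h') ≤ L₊(pm E · h) + L₊(h) ≤ (m + C) ^ C ≤ (n + c) ^ c`,
  `c = (B + 1) C + B + C + 2`.

No `def` is declared. [folklore]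
-/

-- `Summit.ValiantsHypothesis.ValiantsHypothesis.…` is the tree's mandated single-conjunct layout (Sub = Summit).
set_option linter.dupNamespace false

namespace Summit.ValiantsHypothesis.ValiantsHypothesis.Theorems.TriangularDimersDivisionEasy.Shuffling

open scoped BigOperators NNReal
open Finset MvPolynomial Literature.Computability.AlgebraicComplexity

noncomputable section

namespace Extraction
/-! ### Helper lemmas for `stub_rhombusExtraction` (this stub's private namespace), part 2 -/

/-! #### Lowest weighted homogeneous components -/

/-- The coercion to power series commutes with weighted homogeneous components (as
`InitialForm.coe_weightedHomogeneousComponent` of the sibling stub, restated to keep imports minimal).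
[folklore] -/
theorem coe_weightedHomogeneousComponent {R σ : Type*} [CommSemiring R] (w : σ → ℕ) (N : ℕ)
    (q : MvPolynomial σ R) :
    ((weightedHomogeneousComponent w N q : MvPolynomial σ R) : MvPowerSeries σ R) =
      MvPowerSeries.weightedHomogeneousComponent w N (q : MvPowerSeries σ R) := by
  ext d
  simp only [MvPolynomial.coeff_coe, MvPowerSeries.coeff_weightedHomogeneousComponent,
    MvPolynomial.coeff_weightedHomogeneousComponent]

/-- LOWEST COMPONENTS MULTIPLY: if every monomial of `A` has weight `≥ K` and every monomial of `H`
has weight `≥ L`, the component of weight `K + L` of `A * H` is the product of the components of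
weights `K` of `A` and `L` of `H` (Mathlib's power-series statement, pulled back to polynomials).
[folklore] -/
theorem weightedHomogeneousComponent_mul_of_le {R σ : Type*} [CommSemiring R] (w : σ → ℕ)
    (A H : MvPolynomial σ R) {K L : ℕ}
    (hA : ∀ m ∈ A.support, K ≤ Finsupp.weight w m) (hH : ∀ m ∈ H.support, L ≤ Finsupp.weight w m) :
    weightedHomogeneousComponent w (K + L) (A * H) =
      weightedHomogeneousComponent w K A * weightedHomogeneousComponent w L H := by
  have hle : ∀ (P : MvPolynomial σ R) (N : ℕ), (∀ m ∈ P.support, N ≤ Finsupp.weight w m) →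
      (N : ℕ∞) ≤ (P : MvPowerSeries σ R).weightedOrder w := fun P N hP =>
    MvPowerSeries.nat_le_weightedOrder w fun d hd => by
      rw [MvPolynomial.coeff_coe]
      by_contra h0
      exact absurd (hP d (mem_support_iff.mpr h0)) (not_le.mpr hd)
  apply MvPolynomial.coe_injective σ R
  rw [MvPolynomial.coe_mul, coe_weightedHomogeneousComponent, coe_weightedHomogeneousComponent,
    coe_weightedHomogeneousComponent, MvPolynomial.coe_mul]
  exact MvPowerSeries.weightedHomogeneousComponent_mul_of_le_weightedOrder (hle A K hA) (hle H L hH)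

/-- EXTRACTION BY INITIAL FORMS: if initial forms are free (`hI`), `H ≠ 0`, and every monomial of `A`
has weight `≥ K`, then with `HL ≠ 0` the lowest component of `H`: `L₊(HL) ≤ L₊(H)` and
`L₊(A_K · HL) ≤ L₊(A · H)` (`A_K · HL` is the component of weight `K + ord H` of `A · H`). [folklore] -/
theorem extract
    (hI : ∀ (σ : Type) (w : σ → ℕ) (d : ℕ) (p : MvPolynomial σ ℝ≥0),
      (∀ m ∈ p.support, d ≤ Finsupp.weight w m) →
        complexity (weightedHomogeneousComponent w d p) ≤ complexity p)
    {σ : Type} (w : σ → ℕ) (A H : MvPolynomial σ ℝ≥0) (K : ℕ) (hH : H ≠ 0)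
    (hA : ∀ m ∈ A.support, K ≤ Finsupp.weight w m) :
    ∃ HL : MvPolynomial σ ℝ≥0, HL ≠ 0 ∧ complexity HL ≤ complexity H ∧
      complexity (weightedHomogeneousComponent w K A * HL) ≤ complexity (A * H) := by
  classical
  have hfin : (H : MvPowerSeries σ ℝ≥0).weightedOrder w ≠ ⊤ := by
    rwa [Ne, MvPowerSeries.weightedOrder_eq_top_iff, MvPolynomial.coe_eq_zero_iff]
  obtain ⟨L, hL⟩ := ENat.ne_top_iff_exists.mp hfin
  obtain ⟨⟨d, hd, hdL⟩, hlt⟩ := (MvPowerSeries.weightedOrder_eq_nat w).mp hL.symm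
  have hHw : ∀ m ∈ H.support, L ≤ Finsupp.weight w m := fun m hm => by
    by_contra h
    exact (mem_support_iff.mp hm) (by rw [← MvPolynomial.coeff_coe]; exact hlt m (not_le.mp h))
  refine ⟨weightedHomogeneousComponent w L H, fun h0 => hd ?_, hI σ w L H hHw, ?_⟩
  · have h1 := congrArg (coeff d) h0
    rw [coeff_weightedHomogeneousComponent, if_pos hdL, coeff_zero] at h1
    rwa [MvPolynomial.coeff_coe]
  · rw [← weightedHomogeneousComponent_mul_of_le w A H hA hHw]
    refine hI σ w (K + L) (A * H) fun m hm => ?_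
    obtain ⟨a, ha, b, hb, rfl⟩ := Finset.mem_add.mp (support_mul A H hm)
    rw [map_add]
    exact add_le_add (hA a ha) (hHw b hb)

/-! #### Free substitutions -/

/-- Setting the ε-variables to `1` (and keeping the others) costs nothing. [cite: Burgisser2000, Rem. 2.7] -/
theorem complexity_aeval_elim_le {τ υ : Type} [Fintype τ] [Fintype υ]
    (p : MvPolynomial (τ ⊕ υ) ℝ≥0) :
    complexity (aeval (Sum.elim (fun x => (X x : MvPolynomial τ ℝ≥0)) (fun _ => 1)) p) ≤
      complexity p := by
  refine (complexity_aeval_le _ _).trans ?_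
  have h1 : complexity (1 : MvPolynomial τ ℝ≥0) = 0 := by
    rw [← C_1]
    exact complexity_C_holds _
  have hX0 : ∀ i, complexity (X i : MvPolynomial τ ℝ≥0) = 0 := complexity_X_holds
  rw [Fintype.sum_sum_type]
  simp only [Sum.elim_inl, Sum.elim_inr, hX0, h1, Finset.sum_const_zero, add_zero, le_refl]

/-! #### The degenerate layers and the growth bookkeeping -/

/-- For odd `n` the rhombus `R_n` has no dimer cover: a fixed-point-free involution of
`Fin n × Fin n` is a permutation of order `2` without fixed points, forcing `2 ∣ n²`
(adapted from `…TriangularDimersDivisionEasy.Negative.even_of_mem_dimers`). [folklore] -/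
theorem filter_dimers_eq_empty_of_odd {n : ℕ} (hn : Odd n) :
    univ.filter (fun d : Fin n × Fin n → Fin n × Fin n => ∀ v, d (d v) = v ∧ d v ≠ v ∧ AdjR v (d v)) =
      ∅ := by
  -- adapted from Theorems/TriangularDimersDivisionEasy/Negative/Basic.lean (`even_of_mem_dimers`)
  refine Finset.filter_eq_empty_iff.mpr fun d _ hd => ?_
  have hinv : Function.Involutive d := fun v => (hd v).1
  set σ : Equiv.Perm (Fin n × Fin n) := hinv.toPerm d with hσ
  have hσ2 : σ ^ 2 ^ 1 = 1 := by
    rw [pow_one, sq]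
    exact Equiv.ext fun v => by simp [σ, Equiv.Perm.mul_apply, hinv v]
  have hcard : ¬ 2 ∣ Fintype.card (Fin n × Fin n) := by
    rw [Fintype.card_prod, Fintype.card_fin]
    intro h2
    exact (Nat.not_even_iff_odd.2 hn) ((Nat.even_mul.1 (even_iff_two_dvd.2 h2)).elim id id)
  haveI : Fact (Nat.Prime 2) := ⟨Nat.prime_two⟩
  obtain ⟨a, ha⟩ := Equiv.Perm.exists_fixed_point_of_prime hcard hσ2
  exact (hd a).2.1 (by simpa [σ] using ha)

/-- Growth bookkeeping: `(m + C) ^ C ≤ (n + c) ^ c` for `m ≤ (n + B) ^ B` and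
`c = (B + 1) C + B + C + 2`. [folklore] -/
theorem final_bound {B C m n : ℕ} (hm : m ≤ (n + B) ^ B) :
    (m + C) ^ C ≤ (n + ((B + 1) * C + B + C + 2)) ^ ((B + 1) * C + B + C + 2) := by
  set c := (B + 1) * C + B + C + 2 with hc
  have hc1 : B ≤ c := by omega
  have hc2 : 1 + C ≤ n + c := by omega
  have hc3 : (B + 1) * C ≤ c := by omega
  have h1 : m + C ≤ (n + c) ^ (B + 1) :=
    calc m + C ≤ (n + c) ^ B + C * (n + c) ^ B :=
          add_le_add (hm.trans (Nat.pow_le_pow_left (by omega) _))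
            (Nat.le_mul_of_pos_right _ (Nat.one_le_pow _ _ (by omega)))
      _ = (1 + C) * (n + c) ^ B := by ring
      _ ≤ (n + c) * (n + c) ^ B := Nat.mul_le_mul_right _ hc2
      _ = (n + c) ^ (B + 1) := by ring
  calc (m + C) ^ C ≤ ((n + c) ^ (B + 1)) ^ C := Nat.pow_le_pow_left h1 _
    _ = (n + c) ^ ((B + 1) * C) := by rw [← pow_mul]
    _ ≤ (n + c) ^ c := Nat.pow_le_pow_right (by omega) hc3

/-! #### The even layers -/

/-- THE EXTRACTION at an even layer: from `h ≠ 0` for the supergraph `E ⊇ ι(R_n)` (with outer matching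
`g`) to `h' ≠ 0` for the rhombus with `L₊(D_n · h') + L₊(h') ≤ L₊(pm E · h) + L₊(h)`. [folklore] -/
theorem even_case
    (hI : ∀ (σ : Type) (w : σ → ℕ) (d : ℕ) (p : MvPolynomial σ ℝ≥0),
      (∀ m ∈ p.support, d ≤ Finsupp.weight w m) →
        complexity (weightedHomogeneousComponent w d p) ≤ complexity p)
    {n k : ℕ} (ι : Fin n × Fin n ↪ Fin k) (E : Fin k → Fin k → Bool) (g : Fin k → Fin k)
    (hE : ∀ v w, AdjR v w → E (ι v) (ι w) = true)
    (hg : ∀ u, u ∉ Set.range ι → g (g u) = u ∧ g u ≠ u ∧ g u ∉ Set.range ι ∧ E u (g u) = true)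
    (h : MvPolynomial (Fin k × Fin k) ℝ≥0) (hh : h ≠ 0) :
    ∃ h' : MvPolynomial ((Fin n × Fin n) × (Fin n × Fin n)) ℝ≥0, h' ≠ 0 ∧
      complexity ((∑ d ∈ univ.filter (fun d : Fin n × Fin n → Fin n × Fin n =>
            ∀ v, d (d v) = v ∧ d v ≠ v ∧ AdjR v (d v)),
          ∏ v, (X (v, d v) : MvPolynomial ((Fin n × Fin n) × (Fin n × Fin n)) ℝ≥0)) * h') +
        complexity h' ≤ complexity (pm E * h) + complexity h := by
  obtain ⟨lab, hlab⟩ := exists_lab ι g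
  obtain ⟨ext, hext⟩ := exists_ext ι g
  set wt : (Fin n × Fin n) × (Fin n × Fin n) ⊕ Bool → ℕ := Sum.elim (fun _ => 0) fun b => cond b 1 2
    with hwt
  have hH0 : rename lab h ≠ 0 := fun h0 => by
    have h1 : eval (fun _ => (1 : ℝ≥0)) (rename lab h) = eval (fun _ => 1) h := eval_rename _ _ _
    rw [h0, map_zero] at h1
    exact (Division.eval_pos_of_ne_zero h (fun _ => 1) hh fun _ => one_pos).ne h1
  obtain ⟨HL, hHL0, hcHL, hcAHL⟩ := extract hI wt (rename lab (pm E)) (rename lab h) #(univ.map ι)ᶜ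
    hH0 (fun m hm => le_weight_of_mem_support hwt hlab hm)
  rw [rhombusExtraction_key hwt hlab hext hE hg, ← map_mul] at hcAHL
  set ψ := aeval (R := ℝ≥0) (Sum.elim
    (fun x : (Fin n × Fin n) × (Fin n × Fin n) =>
      (X x : MvPolynomial ((Fin n × Fin n) × (Fin n × Fin n)) ℝ≥0))
    (fun _ : Bool => 1)) with hψ
  have hψle : ∀ p, complexity (ψ p) ≤ complexity p := fun p => by
    rw [hψ]
    exact complexity_aeval_elim_le p
  refine ⟨ψ HL, Division.aeval_ne_zero HL _ hHL0 fun i => ?_, ?_⟩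
  · cases i with
    | inl x => exact X_ne_zero _
    | inr b => exact one_ne_zero
  · have hid : (∑ d ∈ univ.filter (fun d : Fin n × Fin n → Fin n × Fin n =>
            ∀ v, d (d v) = v ∧ d v ≠ v ∧ AdjR v (d v)),
          ∏ v, (X (v, d v) : MvPolynomial ((Fin n × Fin n) × (Fin n × Fin n)) ℝ≥0)) * ψ HL =
        ψ (X (Sum.inr true) ^ #(univ.map ι)ᶜ *
          rename Sum.inl (∑ d ∈ univ.filter (fun d : Fin n × Fin n → Fin n × Fin n =>
              ∀ v, d (d v) = v ∧ d v ≠ v ∧ AdjR v (d v)),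
            ∏ v, (X (v, d v) : MvPolynomial ((Fin n × Fin n) × (Fin n × Fin n)) ℝ≥0)) * HL) := by
      rw [map_mul, map_mul, map_pow, hψ, aeval_X, Sum.elim_inr, one_pow, one_mul, aeval_rename,
        Sum.elim_comp_inl, aeval_X_left_apply]
    rw [hid]
    calc _ ≤ _ + complexity HL := add_le_add (hψle _) (hψle _)
      _ ≤ complexity (rename lab (pm E * h)) + complexity (rename lab h) := add_le_add hcAHL hcHL
      _ ≤ complexity (pm E * h) + complexity h :=
          add_le_add (complexity_rename_le_holds' _ _) (complexity_rename_le_holds' _ _)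

end Extraction

open Extraction in
/-- **Registered stub `stub_rhombusExtraction`** (crux stmt-ValiantsHypothesis-5067, line `diagonal-spider-shuffling`).
RHOMBUS EXTRACTION: if initial forms are free for monotone circuits over `ℝ≥0` (`hI`) and a cofinal
supergraph family of the even rhombi has polynomial division complexity (`hP`:
`L₊(pm (E m) · h) + L₊(h) ≤ (m + C) ^ C`, `h ≠ 0`), then the dimer polynomial `D_n` of the
`n × n` triangular rhombus (the crux's polynomial, doubled oriented edge variables) satisfies
`L₊(D_n · h') + L₊(h') ≤ (n + c) ^ c` for some `h' ≠ 0`, with `c = (B + 1) C + B + C + 2`.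
Proof: odd `n` is degenerate (`D_n = 0`); for even `n` relabel the variables of `pm (E m)` with
ε-weights (rhombus edges `0`, outer matching `1`, the rest `2`), take lowest ε-components — they
multiply, the one of `pm (E m)` is `ε₁ ^ K · D_n` (`Extraction.rhombusExtraction_key`), and they are free
(`hI`) —
then set `ε = 1` (idea: ε-deformation + "initial forms are free" for monotone computations,
cf. Jukna–Seiwert–Sergeev; substitution bound Bürgisser 2000 Rem. 2.7). [folklore] -/
theorem stub_rhombusExtraction
    (hI : ∀ (σ : Type) (w : σ → ℕ) (d : ℕ) (p : MvPolynomial σ ℝ≥0),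
      (∀ m ∈ p.support, d ≤ Finsupp.weight w m) →
        complexity (weightedHomogeneousComponent w d p) ≤ complexity p)
    (hP : ∃ (B C : ℕ) (sz : ℕ → ℕ) (E : ∀ m, Fin (sz m) → Fin (sz m) → Bool),
      Cofinal B sz E ∧
      ∀ m, ∃ h : MvPolynomial (Fin (sz m) × Fin (sz m)) ℝ≥0,
        h ≠ 0 ∧ complexity (pm (E m) * h) + complexity h ≤ (m + C) ^ C) :
    ∃ c : ℕ, ∀ n : ℕ, ∃ h : MvPolynomial ((Fin n × Fin n) × (Fin n × Fin n)) NNReal, h ≠ 0 ∧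
      Literature.Computability.AlgebraicComplexity.complexity ((∑ f ∈ (Finset.univ : Finset (Fin n × Fin n → Fin n × Fin n)).filter (fun f => ∀ v, f (f v) = v ∧ f v ≠ v ∧ (((v.1 : ℕ) + 1 = (f v).1 ∧ (v.2 : ℕ) = (f v).2) ∨ (((f v).1 : ℕ) + 1 = v.1 ∧ (v.2 : ℕ) = (f v).2) ∨ ((v.1 : ℕ) = (f v).1 ∧ (v.2 : ℕ) + 1 = (f v).2) ∨ ((v.1 : ℕ) = (f v).1 ∧ ((f v).2 : ℕ) + 1 = v.2) ∨ ((v.1 : ℕ) + 1 = (f v).1 ∧ ((f v).2 : ℕ) + 1 = v.2) ∨ (((f v).1 : ℕ) + 1 = v.1 ∧ (v.2 : ℕ) + 1 = (f v).2))), ∏ v : Fin n × Fin n, (MvPolynomial.X (v, f v) : MvPolynomial ((Fin n × Fin n) × (Fin n × Fin n)) NNReal)) * h) + Literature.Computability.AlgebraicComplexity.complexity h ≤ (n + c) ^ c := by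
  obtain ⟨B, C, sz, E, hcof, hdiv⟩ := hP
  refine ⟨(B + 1) * C + B + C + 2, fun n => ?_⟩
  show ∃ h : MvPolynomial ((Fin n × Fin n) × (Fin n × Fin n)) ℝ≥0, h ≠ 0 ∧
    complexity ((∑ d ∈ univ.filter (fun d : Fin n × Fin n → Fin n × Fin n =>
        ∀ v, d (d v) = v ∧ d v ≠ v ∧ AdjR v (d v)),
      ∏ v, (X (v, d v) : MvPolynomial ((Fin n × Fin n) × (Fin n × Fin n)) ℝ≥0)) * h) +
      complexity h ≤ (n + ((B + 1) * C + B + C + 2)) ^ ((B + 1) * C + B + C + 2)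
  rcases Nat.even_or_odd n with hn | hn
  · obtain ⟨m, hm, ι, hE, g, hg⟩ := hcof n hn
    obtain ⟨h, hh, hc⟩ := hdiv m
    obtain ⟨h', hh', hc'⟩ := even_case hI ι (E m) g hE hg h hh
    exact ⟨h', hh', hc'.trans (hc.trans (final_bound hm))⟩
  · refine ⟨1, one_ne_zero, ?_⟩
    have h0 : complexity (0 : MvPolynomial ((Fin n × Fin n) × (Fin n × Fin n)) ℝ≥0) = 0 := by
      rw [← C_0]
      exact complexity_C_holds _
    have h1 : complexity (1 : MvPolynomial ((Fin n × Fin n) × (Fin n × Fin n)) ℝ≥0) = 0 := by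
      rw [← C_1]
      exact complexity_C_holds _
    rw [filter_dimers_eq_empty_of_odd hn, Finset.sum_empty, zero_mul, h0, h1]
    exact Nat.zero_le _

end

end Summit.ValiantsHypothesis.ValiantsHypothesis.Theorems.TriangularDimersDivisionEasy.Shuffling
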